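import Summits.QuantumFields.BalabanUV.T4Continuum.Support.NE4TransferModel
import Literature.MathematicalPhysics.QuantumFieldTheory.Balaban1983to89.T4CurrencyMatching

/-!
# NE4TransferResolvent — node U2 (spine estimate NE4) by the RESOLVENT / GENERATING-FUNCTION ROUTE, file 2 of 2: row (a)
# `T4CouplingMatching.RemainderShiftRate` from the one-step leaves + the one-step η-source, node U2's TRIPLE
# `ScaleShiftRate ∧ HistLipschitz ∧ FadingMemory` BY NAME, and the K-UNIFORM `T4CauchySum.InjectedRate` END TO END
# (cell `pub-balaban`, rung (B)+1 on a fixed torus T⁴; BINDER-OWNERS row NE4, co-owner #3, lineage `b2b-balaban-t4-ne4-p3`,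
# generation 1; file 1 = `Support/NE4TransferModel` (the model, the leaves, row (b)); companion record
# `t4/skeletons/NE4-t4-ne4-p3.md`)

HONEST FRAMING (T4-DAG PAGE 1).  Rung (B)+1 scoping on a FIXED finite torus — NOT infinite volume, NOT a mass gap, NOT the
Clay problem.  NE4 is a cell NEW ESTIMATE, NOT PRINTED in [Balaban1987RG1]–[Balaban1989LargeFieldII] and NOT PROVED here:
every hypothesis of file 1's `StepTransferModel` leaves is a displayed binder of the theorems below, discharged by nobody;
`FlowStep.BetaPertH`, (B), (B^μ) do not occur (the β sub-cell's (AF-0r) enters as the binder `hconv`; (B) sits BY TYPE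
inside the leaf `Admissible`; NE2/NE3 sit BY NAME inside the leaf `StepScaleShift`).  Every theorem is kernel bookkeeping
(finite sums, the tree's exact resolvent `T4BetaMemorySharp.renewal_le`, and compositions BY NAME with
`T4CouplingMatching.scaleShiftRate_of_split` and `T4CurrencyMatching.injectedRate_of_runs_gap`).  HONEST DEPENDENCY
(verbatim): continuum YM on T⁴ ⇐ BetaPertH ∧ nine spine estimates (0/9 proved); BetaPertH ⇐ (D1) ∧ (D4) ∧ CAP+tail;
G-an2-4 gates asym, D1 and NE2/3/4.

WHAT IS PROVED (kernel, `[folklore]` bookkeeping; the route and the dictionary are described in file 1's docstring).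
 §4 `transfer_pair_le`, `shift_step`, `shift_bound`: along one windowed coupling sequence `g` (the LONGER run; the shorter
    run reads `n ↦ g (n+1)` — the cell's infrared pairing, `T4CouplingMatching` §3: run B's finest coupling unpartnered,
    `Fin.tail`), the paired discrepancy `σ_j = ‖B (j+1) (g₀..g_{j+1}) − B j (g₁..g_{j+1})‖` of the stored brackets obeys the
    ONE-STEP majorant `σ_j ≤ bρ^j + C_F·C_W·E₀·ω^j + C_F·C_W·Σ_{m<j} ω^{j−1−m}σ_m` (η-source + unpartnered finest bracket of
    age `j` + LINEAR transfer of the older discrepancies) and hence, by the exact resolvent, `σ_j ≤ A·θ^j` for every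
    `θ > ν = ω + C_F·C_W`, `θ ≥ ρ` — node U3's NE5 for the stored brackets, DERIVED from one-step leaves;
    **`remainderShiftRate_of_model`**: `T4CouplingMatching.RemainderShiftRate S (shiftConst …) θ γ`.
 §5 **`ne4Triple_of_model`**: with (AF-0r) `hconv`, `ScaleShiftRate (2c₀ + shiftConst …) θ γ β ∧ HistLipschitz (moduli …) γ β ∧
    FadingMemory (ℓ + C_r·C_W·ℓ′/ν) ν (moduli …)` — LITERALLY node U2's shapes (the inputs of the row's END faces
    `Support/NE4ReadOutSocket*` and of `T4BetaReadOut.ne4_of_u3`-type sockets, here PRODUCED rather than read off NE5/NE9).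
 §6 **`injectedRate_of_model`**: + IR-pinned windowed runs of (0.20) + node U2's printed-TYPE γ-window ⟹
    `T4CauchySum.InjectedRate (2(2c₀ + shiftConst …)/(1 − θ)) 0 θ (fun K j ↦ disc (g K) (g (K+1)) j)`, constant INDEPENDENT
    OF K (via `T4CurrencyMatching.injectedRate_of_runs_gap`; the memory gap `ν < θ` is automatic on this route).
NOT COVERED: any instantiation of `StepTransferModel` on Bałaban's objects (the swarm's work: file 1's DICTIONARY); the
β⁰-half (AF-0r); the endpoint existence of the runs (node H3, `FlowStepRuns`); nothing about infinite volume or a mass gap.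

References (TYPES only): [Balaban1987RG1] (0.20) p. 256, Thm 2 p. 259, (1.20)–(1.22) p. 264, (2.12)–(2.15) p. 268;
[Balaban1988RG2Cluster] Lemma 1 p. 9, (2.14) p. 15, (2.18) p. 16, Lemma 3 p. 20, (2.41) p. 21 (renders read as images by
this seat); [King1986] Thm 3.4 (3.9) (shape).  No `sorry`; axioms ⊆ {propext, Classical.choice, Quot.sound}.
-/

noncomputable section

open scoped BigOperators
open Finset

namespace Summit.QuantumFields.BalabanUV.T4Continuum.NE4TransferResolvent

open Literature.MathematicalPhysics.QuantumFieldTheory.Balaban1983to89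
open Literature.MathematicalPhysics.QuantumFieldTheory.Balaban1983to89.FlowStep
open Literature.MathematicalPhysics.QuantumFieldTheory.Balaban1983to89.T4CouplingMatching
open Literature.MathematicalPhysics.QuantumFieldTheory.Balaban1983to89.T4BetaMemorySharp (acc acc_zero acc_succ state_le
  renewal_le)
open Literature.MathematicalPhysics.QuantumFieldTheory.Balaban1983to89.T4OutputRate (Window mem_window)
open Summit.QuantumFields.BalabanUV.T4Continuum.NE4TransferModel
open Summit.QuantumFields.BalabanUV.T4Continuum.NE4TransferModel.StepTransferModel

variable {𝔅 𝔸 : Type*} [NormedAddCommGroup 𝔅] [NormedSpace ℝ 𝔅] [NormedAddCommGroup 𝔸] [NormedSpace ℝ 𝔸]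

/-! ## §4 Row (a): the remainder's scale-shift rate from the one-step leaves + the one-step η-source -/

omit [NormedSpace ℝ 𝔅] in
/-- Index bookkeeping for the padded family: the transfer weights of a `vecCons` family at depth `j + 1` split into the
weight `ω^j` of the oldest slot and the depth-`j` weights of the rest. [folklore] -/
theorem weightSum_cons (ω : ℝ) {j : ℕ} (x : 𝔅) (f : Fin j → 𝔅) :
    ∑ i : Fin (j + 1), ω ^ (j + 1 - 1 - (i : ℕ)) * ‖Matrix.vecCons x f i‖
      = ω ^ j * ‖x‖ + ∑ m : Fin j, ω ^ (j - 1 - (m : ℕ)) * ‖f m‖ := by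
  rw [Fin.sum_univ_succ]
  simp only [Matrix.cons_val_zero, Matrix.cons_val_succ, Fin.val_zero, Fin.val_succ, Nat.add_sub_cancel,
    Nat.sub_zero]
  congr 1
  refine Finset.sum_congr rfl fun m _ => ?_
  have : j - ((m : ℕ) + 1) = j - 1 - (m : ℕ) := by omega
  rw [this]

section Pairing

variable {M : StepTransferModel 𝔅 𝔸}

/-- The older family of the LONGER run (depth `j+1`, sequence `g`) against the older family of the SHORTER run (depth `j`,
shifted sequence `n ↦ g (n+1)`) padded with a silent oldest slot: the difference family has the unpartnered finest bracket
`B 0 (g₀)` in slot `0` and the paired scale-shift discrepancies in the slots `m + 1`. [folklore] -/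
theorem older_succ_sub_cons (j : ℕ) (g : ℕ → ℝ) :
    M.older (j + 1) g - Matrix.vecCons 0 (M.older j (fun n => g (n + 1))) =
      Matrix.vecCons (M.B 0 (prefixOf g 0))
        (fun m : Fin j => M.B ((m : ℕ) + 1) (prefixOf g ((m : ℕ) + 1)) - M.B m (prefixOf (fun n => g (n + 1)) m)) := by
  funext i
  refine Fin.cases ?_ (fun m => ?_) i
  · simp [older]
  · simp [older]

/-- TRANSFER OF THE PAIRED FAMILY (kernel): at depth `j + 1` and the common current coupling `g (j+1)`, the activities of the
longer run and of the padded shorter run differ by at most `C_W·(E₀·ω^j + Σ_{m<j} ω^{j−1−m}σ_m)` — the unpartnered finest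
bracket (age `j`, size `≤ E₀`) plus the age-weighted paired discrepancies `σ_m`; LINEARITY of the transfer + `TransferBound`.
[folklore] -/
theorem transfer_pair_le {γ C_W ω E₀ : ℝ} (hT : M.TransferBound C_W ω γ) (hAdm : M.Admissible E₀ γ) (hCW : 0 ≤ C_W)
    (hω : 0 ≤ ω) {g : ℕ → ℝ} (hg : g ∈ Window γ) (j : ℕ) :
    ‖M.W (j + 1) (g (j + 1)) (M.older (j + 1) g) - M.W (j + 1) (g (j + 1)) (Matrix.vecCons 0 (M.older j (fun n => g (n + 1))))‖
      ≤ C_W * (E₀ * ω ^ j +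
          acc ω (fun m => ‖M.B (m + 1) (prefixOf g (m + 1)) - M.B m (prefixOf (fun n => g (n + 1)) m)‖) j) := by
  have hlin : M.W (j + 1) (g (j + 1)) (M.older (j + 1) g)
      - M.W (j + 1) (g (j + 1)) (Matrix.vecCons 0 (M.older j (fun n => g (n + 1))))
      = M.W (j + 1) (g (j + 1)) (M.older (j + 1) g - Matrix.vecCons 0 (M.older j (fun n => g (n + 1)))) := by
    rw [map_sub]
  rw [hlin, older_succ_sub_cons]
  refine (hT (j + 1) (g (j + 1)) _ (hg (j + 1)).1 (hg (j + 1)).2).trans (mul_le_mul_of_nonneg_left ?_ hCW)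
  rw [weightSum_cons, sum_fin_weight_eq_acc ω
    (fun m => ‖M.B (m + 1) (prefixOf g (m + 1)) - M.B m (prefixOf (fun n => g (n + 1)) m)‖) j]
  have hB0 : ‖M.B 0 (prefixOf g 0)‖ ≤ E₀ := hAdm 0 g hg
  have h0 : ω ^ j * ‖M.B 0 (prefixOf g 0)‖ ≤ E₀ * ω ^ j := by
    rw [mul_comm]; exact mul_le_mul_of_nonneg_right hB0 (pow_nonneg hω _)
  linarith

/-- THE ONE-STEP SCALE-SHIFT INEQUALITY (kernel).  Along a windowed sequence `g` (the longer run; the shorter run reads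
`n ↦ g (n+1)`), the paired discrepancy `σ_j = ‖B (j+1) (g₀..g_{j+1}) − B j (g₁..g_{j+1})‖` obeys
`σ_j ≤ (bρ^j + C_F·C_W·E₀·ω^j) + C_F·C_W·Σ_{m<j} ω^{j−1−m}σ_m` — one-step η-source + transfer of the unpartnered finest
bracket (age `j`) + transfer of the older discrepancies. [folklore] -/
theorem shift_step {γ C_W ω C_F C_r E₀ b b_r ρ : ℝ} (hRep : M.Represents γ) (hT : M.TransferBound C_W ω γ)
    (hA : M.ActivityLipschitz C_F C_r E₀ γ) (hAdm : M.Admissible E₀ γ) (hS : M.StepScaleShift b b_r ρ E₀ γ)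
    (hCF : 0 ≤ C_F) (hCW : 0 ≤ C_W) (hE₀ : 0 ≤ E₀) (hω : 0 ≤ ω) {g : ℕ → ℝ} (hg : g ∈ Window γ) (j : ℕ) :
    ‖M.B (j + 1) (prefixOf g (j + 1)) - M.B j (prefixOf (fun n => g (n + 1)) j)‖ ≤
      (b * ρ ^ j + C_F * C_W * E₀ * ω ^ j) + C_F * C_W *
        acc ω (fun m => ‖M.B (m + 1) (prefixOf g (m + 1)) - M.B m (prefixOf (fun n => g (n + 1)) m)‖) j := by
  set g' : ℕ → ℝ := fun n => g (n + 1) with hg'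
  have hwg' : g' ∈ Window γ := shift_mem_window hg
  have hc0 : 0 < g (j + 1) := (hg (j + 1)).1
  have hcγ : g (j + 1) ≤ γ := (hg (j + 1)).2
  have hEB : ∀ i : Fin (j + 1), ‖M.older (j + 1) g i‖ ≤ E₀ := fun i => hAdm i g hg
  have hEA : ∀ i : Fin j, ‖M.older j g' i‖ ≤ E₀ := fun i => hAdm i g' hwg'
  have hEA0 : ∀ i : Fin (j + 1), ‖(Matrix.vecCons (0 : 𝔅) (M.older j g')) i‖ ≤ E₀ := by
    intro i; refine Fin.cases ?_ (fun m => ?_) i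
    · simpa using hE₀
    · simpa using hEA m
  rw [hRep (j + 1) g hg, hRep j g' hwg']
  have h1 := (hA (j + 1) (g (j + 1)) (M.older (j + 1) g) (Matrix.vecCons 0 (M.older j g')) hc0 hcγ hEB hEA0).1
  have h2 := (hS j (g (j + 1)) (M.older j g') hc0 hcγ hEA).1
  have h3 := transfer_pair_le hT hAdm hCW hω hg j
  calc ‖M.N (j + 1) (g (j + 1)) (M.act (j + 1) g) - M.N j (g' j) (M.act j g')‖
      ≤ ‖M.N (j + 1) (g (j + 1)) (M.act (j + 1) g)
          - M.N (j + 1) (g (j + 1)) (M.W (j + 1) (g (j + 1)) (Matrix.vecCons 0 (M.older j g')))‖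
        + ‖M.N (j + 1) (g (j + 1)) (M.W (j + 1) (g (j + 1)) (Matrix.vecCons 0 (M.older j g')))
          - M.N j (g' j) (M.act j g')‖ := norm_sub_le_norm_sub_add_norm_sub _ _ _
    _ ≤ C_F * ‖M.W (j + 1) (g (j + 1)) (M.older (j + 1) g)
          - M.W (j + 1) (g (j + 1)) (Matrix.vecCons 0 (M.older j g'))‖ + b * ρ ^ j := add_le_add h1 h2
    _ ≤ C_F * (C_W * (E₀ * ω ^ j +
          acc ω (fun m => ‖M.B (m + 1) (prefixOf g (m + 1)) - M.B m (prefixOf g' m)‖) j)) + b * ρ ^ j :=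
        add_le_add (mul_le_mul_of_nonneg_left h3 hCF) le_rfl
    _ = _ := by ring

/-- THE PAIRED DISCREPANCIES DECAY GEOMETRICALLY (kernel; = node U3's NE5 for the stored brackets, derived): by the tree's
exact resolvent `T4BetaMemorySharp.renewal_le` applied to `shift_step`, for every target rate `θ` with `ν = ω + C_F·C_W < θ`,
`ρ ≤ θ` (and `0 ≤ ω, ρ`, `θ ≤ 1` not needed here):
`σ_j ≤ (b + C_F·C_W·E₀)·(1 + C_F·C_W/(θ − ν))·θ^j`. [folklore] -/
theorem shift_bound {γ C_W ω C_F C_r E₀ b b_r ρ θ : ℝ} (hRep : M.Represents γ) (hT : M.TransferBound C_W ω γ)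
    (hA : M.ActivityLipschitz C_F C_r E₀ γ) (hAdm : M.Admissible E₀ γ) (hS : M.StepScaleShift b b_r ρ E₀ γ)
    (hCF : 0 ≤ C_F) (hCW : 0 ≤ C_W) (hE₀ : 0 ≤ E₀) (hω : 0 ≤ ω) (hb : 0 ≤ b) (hρ : 0 ≤ ρ) (hρθ : ρ ≤ θ)
    (hνθ : ω + C_F * C_W < θ) {g : ℕ → ℝ} (hg : g ∈ Window γ) (j : ℕ) :
    ‖M.B (j + 1) (prefixOf g (j + 1)) - M.B j (prefixOf (fun n => g (n + 1)) j)‖ ≤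
      (b + C_F * C_W * E₀) * (1 + C_F * C_W / (θ - (ω + C_F * C_W))) * θ ^ j := by
  set c : ℝ := C_F * C_W with hc
  have hc0 : 0 ≤ c := mul_nonneg hCF hCW
  have hν0 : 0 ≤ ω + c := add_nonneg hω hc0
  have hωθ : ω ≤ θ := by linarith
  have hθ0 : 0 ≤ θ := hρ.trans hρθ
  set σ : ℕ → ℝ := fun m => ‖M.B (m + 1) (prefixOf g (m + 1)) - M.B m (prefixOf (fun n => g (n + 1)) m)‖ with hσ
  set f : ℕ → ℝ := fun m => b * ρ ^ m + c * E₀ * ω ^ m with hf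
  have hstep : ∀ n, σ n ≤ f n + c * acc ω σ n := by
    intro n
    have := shift_step hRep hT hA hAdm hS hCF hCW hE₀ hω hg n
    simpa [hσ, hf, hc, mul_assoc] using this
  have hren := renewal_le hω hc0 hstep j
  -- bound the forcing and its accumulated content by the target rate θ
  have hfle : ∀ m, f m ≤ (b + c * E₀) * θ ^ m := by
    intro m
    have h1 : ρ ^ m ≤ θ ^ m := pow_le_pow_left₀ hρ hρθ m
    have h2 : ω ^ m ≤ θ ^ m := pow_le_pow_left₀ hω hωθ m
    have := add_le_add (mul_le_mul_of_nonneg_left h1 hb) (mul_le_mul_of_nonneg_left h2 (mul_nonneg hc0 hE₀))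
    simpa [hf, add_mul] using this
  have hacc : acc (ω + c) f j ≤ (b + c * E₀) * (θ ^ j / (θ - (ω + c))) := by
    calc acc (ω + c) f j ≤ acc (ω + c) (fun m => (b + c * E₀) * θ ^ m) j := acc_le_acc hν0 hfle j
      _ = (b + c * E₀) * acc (ω + c) (fun m => θ ^ m) j := acc_const_mul _ _ _ _
      _ ≤ (b + c * E₀) * (θ ^ j / (θ - (ω + c))) :=
          mul_le_mul_of_nonneg_left (acc_pow_le hν0 hνθ j) (by positivity)
  have hpos : 0 < θ - (ω + c) := sub_pos.mpr hνθ
  calc σ j ≤ f j + c * acc (ω + c) f j := hren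
    _ ≤ (b + c * E₀) * θ ^ j + c * ((b + c * E₀) * (θ ^ j / (θ - (ω + c)))) :=
        add_le_add (hfle j) (mul_le_mul_of_nonneg_left hacc hc0)
    _ = (b + c * E₀) * (1 + c / (θ - (ω + c))) * θ ^ j := by
        field_simp

end Pairing

/-- THE SHIFT CONSTANT of the route: `c₁ = b_r + C_r·C_W·(E₀ + (b + C_F·C_W·E₀)·(1 + C_F·C_W/(θ − ν))/(θ − ω))`,
`ν = ω + C_F·C_W`. [folklore] -/
def shiftConst (b b_r C_F C_r C_W E₀ ω θ : ℝ) : ℝ :=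
  b_r + C_r * C_W * (E₀ + (b + C_F * C_W * E₀) * (1 + C_F * C_W / (θ - (ω + C_F * C_W))) / (θ - ω))

/-- The shift constant is nonnegative in the regime of the route. [folklore] -/
theorem shiftConst_nonneg {b b_r C_F C_r C_W E₀ ω θ : ℝ} (hb : 0 ≤ b) (hbr : 0 ≤ b_r) (hCF : 0 ≤ C_F) (hCr : 0 ≤ C_r)
    (hCW : 0 ≤ C_W) (hE₀ : 0 ≤ E₀) (hνθ : ω + C_F * C_W < θ) :
    0 ≤ shiftConst b b_r C_F C_r C_W E₀ ω θ := by
  unfold shiftConst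
  have h1 : 0 < θ - (ω + C_F * C_W) := sub_pos.mpr hνθ
  have h2 : 0 < θ - ω := by nlinarith [mul_nonneg hCF hCW]
  positivity

/-- **ROW (a) FROM THE ONE-STEP LEAVES (kernel): `T4CouplingMatching.RemainderShiftRate`** — the scale shift of the
remainder `β¹` at infrared-matched couplings decays at every rate `θ ∈ ]ν, 1]` dominating the one-step η-rate `ρ`, with the
constant `shiftConst`.  Hypotheses: the two identifications, `TransferBound`, `ActivityLipschitz`, `Admissible`,
`StepScaleShift`, signs, `ν = ω + C_F·C_W < θ`, `ρ ≤ θ`.  The unpartnered finest bracket of the longer run is a SOURCE of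
weight `ω^k` (derived here, not assumed — H-U2R-3 of the cell record). [folklore] -/
theorem remainderShiftRate_of_model {β : HBeta} (S : B12Beta.OneLoopSplit β) (M : StepTransferModel 𝔅 𝔸)
    {γ C_W ω C_F C_r E₀ b b_r ρ θ : ℝ} (hRep : M.Represents γ) (hRead : M.ReadsRemainder S γ)
    (hT : M.TransferBound C_W ω γ) (hA : M.ActivityLipschitz C_F C_r E₀ γ) (hAdm : M.Admissible E₀ γ)
    (hS : M.StepScaleShift b b_r ρ E₀ γ) (hCF : 0 ≤ C_F) (hCr : 0 ≤ C_r) (hCW : 0 ≤ C_W) (hE₀ : 0 ≤ E₀)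
    (hω : 0 ≤ ω) (hb : 0 ≤ b) (hbr : 0 ≤ b_r) (hρ : 0 ≤ ρ) (hρθ : ρ ≤ θ) (hνθ : ω + C_F * C_W < θ) :
    RemainderShiftRate S (shiftConst b b_r C_F C_r C_W E₀ ω θ) θ γ := by
  intro k w hw
  set g := extend w with hgdef
  have hg : g ∈ Window γ := extend_mem_window hw
  set g' : ℕ → ℝ := fun n => g (n + 1) with hg'
  have hwg' : g' ∈ Window γ := shift_mem_window hg
  have ew : w = prefixOf g (k + 1) := (prefixOf_extend w).symm
  have etail : Fin.tail (prefixOf g (k + 1)) = prefixOf g' k := tail_prefixOf g k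
  rw [ew, etail, hRead (k + 1) g hg, hRead k g' hwg']
  have hc0 : 0 < g (k + 1) := (hg (k + 1)).1
  have hcγ : g (k + 1) ≤ γ := (hg (k + 1)).2
  have hEB : ∀ i : Fin (k + 1), ‖M.older (k + 1) g i‖ ≤ E₀ := fun i => hAdm i g hg
  have hEA : ∀ i : Fin k, ‖M.older k g' i‖ ≤ E₀ := fun i => hAdm i g' hwg'
  have hEA0 : ∀ i : Fin (k + 1), ‖(Matrix.vecCons (0 : 𝔅) (M.older k g')) i‖ ≤ E₀ := by
    intro i; refine Fin.cases ?_ (fun m => ?_) i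
    · simpa using hE₀
    · simpa using hEA m
  -- constants
  set c : ℝ := C_F * C_W with hc
  have hc0' : 0 ≤ c := mul_nonneg hCF hCW
  have hωθ : ω < θ := by linarith
  have hθ0 : 0 ≤ θ := hρ.trans hρθ
  have hposν : 0 < θ - (ω + c) := sub_pos.mpr hνθ
  have hposω : 0 < θ - ω := sub_pos.mpr hωθ
  set A : ℝ := (b + c * E₀) * (1 + c / (θ - (ω + c))) with hA'
  have hA0 : 0 ≤ A := by positivity
  -- the three pieces
  have h1 := (hA (k + 1) (g (k + 1)) (M.older (k + 1) g) (Matrix.vecCons 0 (M.older k g')) hc0 hcγ hEB hEA0).2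
  have h2 := (hS k (g (k + 1)) (M.older k g') hc0 hcγ hEA).2
  have h3 := transfer_pair_le hT hAdm hCW hω hg k
  have hσ : ∀ m, ‖M.B (m + 1) (prefixOf g (m + 1)) - M.B m (prefixOf g' m)‖ ≤ A * θ ^ m :=
    fun m => shift_bound hRep hT hA hAdm hS hCF hCW hE₀ hω hb hρ hρθ hνθ hg m
  have hacc : acc ω (fun m => ‖M.B (m + 1) (prefixOf g (m + 1)) - M.B m (prefixOf g' m)‖) k ≤ A * (θ ^ k / (θ - ω)) := by
    calc acc ω (fun m => ‖M.B (m + 1) (prefixOf g (m + 1)) - M.B m (prefixOf g' m)‖) k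
        ≤ acc ω (fun m => A * θ ^ m) k := acc_le_acc hω hσ k
      _ = A * acc ω (fun m => θ ^ m) k := acc_const_mul _ _ _ _
      _ ≤ A * (θ ^ k / (θ - ω)) := mul_le_mul_of_nonneg_left (acc_pow_le hω hωθ k) hA0
  have hωk : ω ^ k ≤ θ ^ k := pow_le_pow_left₀ hω hωθ.le k
  have hρk : ρ ^ k ≤ θ ^ k := pow_le_pow_left₀ hρ hρθ k
  have hmain : |M.r (k + 1) (g (k + 1)) (M.act (k + 1) g) - M.r k (g' k) (M.act k g')|
      ≤ C_r * (C_W * (E₀ * θ ^ k + A * (θ ^ k / (θ - ω)))) + b_r * θ ^ k := by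
    calc |M.r (k + 1) (g (k + 1)) (M.act (k + 1) g) - M.r k (g' k) (M.act k g')|
        ≤ |M.r (k + 1) (g (k + 1)) (M.act (k + 1) g)
            - M.r (k + 1) (g (k + 1)) (M.W (k + 1) (g (k + 1)) (Matrix.vecCons 0 (M.older k g')))|
          + |M.r (k + 1) (g (k + 1)) (M.W (k + 1) (g (k + 1)) (Matrix.vecCons 0 (M.older k g')))
            - M.r k (g' k) (M.act k g')| := abs_sub_le _ _ _
      _ ≤ C_r * ‖M.W (k + 1) (g (k + 1)) (M.older (k + 1) g)
            - M.W (k + 1) (g (k + 1)) (Matrix.vecCons 0 (M.older k g'))‖ + b_r * ρ ^ k := add_le_add h1 h2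
      _ ≤ C_r * (C_W * (E₀ * ω ^ k +
            acc ω (fun m => ‖M.B (m + 1) (prefixOf g (m + 1)) - M.B m (prefixOf g' m)‖) k)) + b_r * θ ^ k :=
          add_le_add (mul_le_mul_of_nonneg_left h3 hCr) (mul_le_mul_of_nonneg_left hρk hbr)
      _ ≤ C_r * (C_W * (E₀ * θ ^ k + A * (θ ^ k / (θ - ω)))) + b_r * θ ^ k := by
          have : E₀ * ω ^ k + acc ω (fun m => ‖M.B (m + 1) (prefixOf g (m + 1)) - M.B m (prefixOf g' m)‖) k
              ≤ E₀ * θ ^ k + A * (θ ^ k / (θ - ω)) := add_le_add (mul_le_mul_of_nonneg_left hωk hE₀) hacc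
          have := mul_le_mul_of_nonneg_left (mul_le_mul_of_nonneg_left this hCW) hCr
          linarith
  refine hmain.trans (le_of_eq ?_)
  simp only [shiftConst, hA', hc]
  field_simp
  ring

/-! ## §5 Node U2's triple BY NAME (the input of the row's sockets and of `T4CurrencyMatching.injectedRate_of_runs_gap`) -/

/-- **NODE U2's TRIPLE FROM THE ONE-STEP TRANSFER MODEL (kernel)**: with the β sub-cell's (AF-0r)
`|β⁰_{k+1} − β⁰_∞| ≤ c₀θ^k` (binder `hconv`, NOT discharged here) the route yields
`ScaleShiftRate (2c₀ + c₁) θ γ β ∧ HistLipschitz Λ γ β ∧ FadingMemory C_Λ ν Λ` — LITERALLY the shapes of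
`T4CouplingMatching` consumed by the row's END faces (`T4BetaReadOut.ne4_of_u3`-type sockets take them as produced here).
Memory rate `ν = ω + C_F·C_W`; shift rate any `θ ∈ ]max(ν, ρ), 1]`. [folklore] -/
theorem ne4Triple_of_model {β : HBeta} (S : B12Beta.OneLoopSplit β) (M : StepTransferModel 𝔅 𝔸)
    {γ C_W ω C_F C_r ℓ' ℓ E₀ b b_r ρ θ binf c₀ : ℝ} (hRep : M.Represents γ) (hRead : M.ReadsRemainder S γ)
    (hT : M.TransferBound C_W ω γ) (hA : M.ActivityLipschitz C_F C_r E₀ γ) (hC : M.CouplingLipschitz ℓ' ℓ E₀ γ)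
    (hAdm : M.Admissible E₀ γ) (hS : M.StepScaleShift b b_r ρ E₀ γ)
    (hCF : 0 ≤ C_F) (hCr : 0 ≤ C_r) (hCW : 0 ≤ C_W) (hE₀ : 0 ≤ E₀) (hℓ : 0 ≤ ℓ) (hℓ' : 0 ≤ ℓ')
    (hω : 0 < ω) (hb : 0 ≤ b) (hbr : 0 ≤ b_r) (hρ : 0 ≤ ρ) (hρθ : ρ ≤ θ) (hνθ : ω + C_F * C_W < θ) (hθ1 : θ ≤ 1)
    (hc₀ : 0 ≤ c₀) (hconv : ∀ k, |S.β0 k - binf| ≤ c₀ * θ ^ k) :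
    ScaleShiftRate (2 * c₀ + shiftConst b b_r C_F C_r C_W E₀ ω θ) θ γ β ∧
      HistLipschitz (moduli ℓ ℓ' C_r C_W (ω + C_F * C_W)) γ β ∧
      T4CouplingMatching.FadingMemory (ℓ + C_r * C_W * ℓ' / (ω + C_F * C_W)) (ω + C_F * C_W)
        (moduli ℓ ℓ' C_r C_W (ω + C_F * C_W)) := by
  have hθ0 : 0 ≤ θ := hρ.trans hρθ
  have hν : 0 < ω + C_F * C_W := by nlinarith [mul_nonneg hCF hCW]
  refine ⟨?_, ?_, ?_⟩
  · exact scaleShiftRate_of_split S hθ0 hθ1 hc₀ hconv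
      (remainderShiftRate_of_model S M hRep hRead hT hA hAdm hS hCF hCr hCW hE₀ hω.le hb hbr hρ hρθ hνθ)
  · exact histLipschitz_of_model S M hRep hRead hT hA hC hAdm hω.le hCF hCW hCr
  · exact fadingMemory_moduli hℓ hℓ' hCr hCW hν

/-! ## §6 The spine's input: the K-UNIFORM injected rate of the coupling discrepancies, BY NAME -/

/-- **END TO END (kernel): from the ONE-STEP TRANSFER MODEL to node U6's input `T4CauchySum.InjectedRate`** for the
discrepancies `disc (g K) (g (K+1)) j = |1/(g^{(K)}_j)² − 1/(g^{(K+1)}_{j+1})²|` of a family of IR-pinned runs of (0.20), with a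
constant INDEPENDENT OF K.  Inputs: §5's triple (one-step leaves + (AF-0r)), the runs (`RGEqH`, window, pin — printed
recursion (0.20) p. 256 and the renormalization condition of Thm 2 p. 259 of [I]), and node U2's printed-TYPE γ-WINDOW
`hsmall` ([I] Thm 3: «The constant γ depends on all other constants»); composed through
`T4CurrencyMatching.injectedRate_of_runs_gap` (memory gap = `ν < θ`, automatic here).  HONEST: conditional on every
displayed binder; NE2/NE3 (inside `StepScaleShift`), (B) (inside `Admissible`) and (AF-0r) are NOT discharged; NOT infinite
volume, NOT a mass gap, NOT Clay. [folklore] -/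
theorem injectedRate_of_model {β : HBeta} (S : B12Beta.OneLoopSplit β) (M : StepTransferModel 𝔅 𝔸)
    {γ C_W ω C_F C_r ℓ' ℓ E₀ b b_r ρ θ binf c₀ : ℝ} (g : ℕ → ℕ → ℝ) (gIR : ℝ)
    (hRep : M.Represents γ) (hRead : M.ReadsRemainder S γ)
    (hT : M.TransferBound C_W ω γ) (hA : M.ActivityLipschitz C_F C_r E₀ γ) (hC : M.CouplingLipschitz ℓ' ℓ E₀ γ)
    (hAdm : M.Admissible E₀ γ) (hS : M.StepScaleShift b b_r ρ E₀ γ)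
    (hCF : 0 ≤ C_F) (hCr : 0 ≤ C_r) (hCW : 0 ≤ C_W) (hE₀ : 0 ≤ E₀) (hℓ : 0 ≤ ℓ) (hℓ' : 0 ≤ ℓ')
    (hω : 0 < ω) (hb : 0 ≤ b) (hbr : 0 ≤ b_r) (hρ : 0 ≤ ρ) (hρθ : ρ ≤ θ) (hνθ : ω + C_F * C_W < θ) (hθ1 : θ < 1)
    (hc₀ : 0 ≤ c₀) (hconv : ∀ k, |S.β0 k - binf| ≤ c₀ * θ ^ k) (hγ : 0 ≤ γ)
    (hrun : ∀ K, RGEqH K β (g K)) (hbox : ∀ K i, i ≤ K → 0 < g K i ∧ g K i ≤ γ) (hpin : ∀ K, g K K = gIR)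
    (hsmall : (ℓ + C_r * C_W * ℓ' / (ω + C_F * C_W)) * (γ ^ 3 / 2) * (θ / (θ - (ω + C_F * C_W))) ≤ (1 - θ) / 2) :
    T4CauchySum.InjectedRate (2 * (2 * c₀ + shiftConst b b_r C_F C_r C_W E₀ ω θ) / (1 - θ)) 0 θ
      (fun K j => disc (g K) (g (K + 1)) j) := by
  obtain ⟨hSh, hL, hΛ⟩ := ne4Triple_of_model S M hRep hRead hT hA hC hAdm hS hCF hCr hCW hE₀ hℓ hℓ' hω hb hbr hρ hρθ
    hνθ hθ1.le hc₀ hconv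
  have hθ0 : 0 < θ := by nlinarith [mul_nonneg hCF hCW]
  have hν0 : 0 ≤ ω + C_F * C_W := by nlinarith [mul_nonneg hCF hCW]
  have hc : 0 ≤ 2 * c₀ + shiftConst b b_r C_F C_r C_W E₀ ω θ := by
    have := shiftConst_nonneg hb hbr hCF hCr hCW hE₀ hνθ
    linarith
  have hCΛ : 0 ≤ ℓ + C_r * C_W * ℓ' / (ω + C_F * C_W) := by positivity
  exact T4CurrencyMatching.injectedRate_of_runs_gap g gIR hθ0 hθ1 hθ0.le le_rfl hν0 hνθ hc hCΛ hγ hrun hbox hpin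
    hSh hL hΛ hsmall

end Summit.QuantumFields.BalabanUV.T4Continuum.NE4TransferResolvent
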